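import Summits.PneNP.PneNP.Theorems.SzkEntropyPeaThreeNotInPLatticeStubGap
import Summits.PneNP.PneNP.Theorems.SzkEntropyPeaThreeNotInPLatticeStubInstanceFP
import Summits.PneNP.PneNP.Theorems.SzkEntropyPeaThreeNotInPLatticeStubAffineFP
import Summits.PneNP.PneNP.Theorems.SzkEntropyPeaThreeNotInPSocketPEDGapAssembly
import Summits.PneNP.PneNP.Theorems.SzkEntropyPeaThreeNotInPSocketLatticeGlue
import Summits.PneNP.PneNP.Theorems.SzkEntropyPeaThreeNotInPSocketBridge
import Summits.PneNP.PneNP.Theses.Lattice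
import Literature.Computability.Complexity.PromiseZPPProofs
import Literature.Computability.Complexity.PromiseBPPClosureProofs
import Summits.PneNP.PneNP.Theorems.SzkEntropyPeaThreeNotInPKillSwitch
import Literature.Computability.Cryptography.LatticeOWF
import HarnessLib

/-!
# Crux `PeaThreeNotInP` (stmt-PneNP-10776), line `SketchIdeator3`, socket client
# `lattice-cube-smoothing`: ASSEMBLY — `GapCVP_n ≤ₚ (PEDBPGap 1 10).swap`, hence
# `LatticeGapsvpNNotP → PeaThreeNotInP`

The certified import of polynomial-factor lattice hardness into thesis X of route SzkEntropy:

* `latRed_polyTimeReducible : (gapCVPPromise (fun n => n)).PolyTimeReducible (PEDBPGap 1 10).swap`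
  — the Karp reduction by cube-smoothed coset samplers (instance map `latRed`, computed on codes
  by the guarded raw map `latRedG`: `stub_instanceFP stub_affineFP`; correctness `stub_gap`);
* `peaThreeNotInP_of_latticeGapsvpNNotP : LatticeGapsvpNNotP → PeaThreeNotInP` — with the
  Goldreich–Micciancio–Safra–Seifert glue `GapSVP_n ∉ prP ⟹ GapCVP_n ∉ prP`
  (`gapCVPPromise_not_mem_of_gapSVPPromise_not_mem`), closure of promise-`P` under `swap`, and the
  weak-gap socket `peaThreeNotInP_of_PEDBPGap_not_mem` (DGRV Thm 4.6 over the tree's AIK encoding);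
* the RANDOMISED form (the shape in which lattice hardness is assumed in cryptography):
  `not_peaThreeMemBPP_of_gapSVPPromise_not_mem : gapSVPPromise (fun n => n) ∉ PromiseBPP' → ¬ PeaThreeMemBPP`
  (so `PEA₃ ∉ prBPP`), whence X again by the kill-switch lemma
  (`peaThreeNotInP_of_gapSVPPromise_not_mem_PromiseBPP'`).

So X (`PEA₃ ∉ prP`, ⟺ `SZKP_L ⊄ prP`) is a CONSEQUENCE of the retired Lattice route's thesis
`GapSVP_n ∉ PromiseP` (`Summit.PneNP.PneNP.Theses.Lattice.LatticeGapsvpNNotP`), the founding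
worst-case assumption of lattice cryptography at a factor below every deployed one.  X remains
OPEN; this file does not prove it.

References: O. Goldreich, S. Goldwasser, JCSS 60 (2000) §3; D. Micciancio, S. Vadhan, CRYPTO 2003
§3; Z. Dvir, D. Gutfreund, G. N. Rothblum, S. Vadhan, ECCC TR10-160 (2010) §4.2–4.4, Thm 4.6;
O. Goldreich, D. Micciancio, S. Safra, J.-P. Seifert, IPL 71 (1999).
-/

namespace Summit.PneNP.PneNP.Cruxes.PeaThreeNotInP.LatticeLine

set_option linter.dupNamespace false -- `Summit.PneNP.PneNP.…`: summit = sub-problem name (D-0017)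

open _root_.Computability
open Literature.Computability.Complexity Literature.Algebra.EuclideanLattices
open Summit.PneNP.PneNP.Cruxes.PeaThreeNotInP.SocketBP (PEDBPGap peaThreeNotInP_of_PEDBPGap_not_mem
  not_peaThreeMemBPP_of_PEDBPGap gapCVPPromise_not_mem_of_gapSVPPromise_not_mem encode_eq_pedbpE)
open Summit.PneNP.PneNP.Theses.SzkEntropy (PeaThreeNotInP PeaThreeMemBPP)
open Summit.PneNP.PneNP.Theorems (szkEntropy_peaThreeNotInP_of_not_peaThreeMemBPP)
open Literature.Computability.Cryptography (mem_PromiseBPP'_of_subset)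
open Summit.PneNP.PneNP.Theses.Lattice (LatticeGapsvpNNotP)

/-- **`GapCVP_n ≤ₚ (PEDBPGap 1 10).swap`** by the cube-smoothed coset samplers: the string
function of `stub_instanceFP stub_affineFP` computes `latRed` on codes (`latRedG_cvpTup`), and
`stub_gap` sends YES to NO and NO to YES. [cite: DvirGutfreundRothblumVadhan2010, §4.4] -/
theorem latRed_polyTimeReducible :
    (gapCVPPromise (fun n => (n : ℝ))).PolyTimeReducible (PEDBPGap 1 10).swap := by
  obtain ⟨F, hF, hFr⟩ := stub_instanceFP stub_affineFP
  have hred : ∀ p : GapCVPInstance,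
      F (GapCVPInstance.encode p) = PEDBPInst.encoding.encode (latRed p) := by
    intro p
    rw [GapCodes.encode_eq_cvpTupE, hFr, encode_eq_pedbpE, latRedG_cvpTup]
  refine ⟨F, hF, ?_, ?_⟩
  · rintro w ⟨p, hp, rfl⟩
    show F (GapCVPInstance.encode p) ∈ (PEDBPGap 1 10).no
    rw [hred]
    exact stub_gap.1 p hp
  · rintro w ⟨p, hp, rfl⟩
    show F (GapCVPInstance.encode p) ∈ (PEDBPGap 1 10).yes
    rw [hred]
    exact stub_gap.2 p hp

/-- **Hardness of `GapCVP` at factor `n` gives the crux**: `GapCVP_n ∉ prP ⟹ PEA₃ ∉ prP`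
(this reduction, closure of promise-`P` under `swap`, the weak-gap socket).
[cite: DvirGutfreundRothblumVadhan2010, Thm 4.6] -/
theorem peaThreeNotInP_of_gapCVPPromise_not_mem
    (h : gapCVPPromise (fun n => (n : ℝ)) ∉ PromiseP) : PeaThreeNotInP :=
  peaThreeNotInP_of_PEDBPGap_not_mem Nat.one_pos (by norm_num) fun hmem =>
    h (PromiseProblem.mem_PromiseP_of_polyTimeReducible_holds latRed_polyTimeReducible
      (swap_mem_PromiseP hmem))

/-- **The lattice import**: the Lattice route's thesis `GapSVP_n ∉ PromiseP` implies thesis X of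
route SzkEntropy, `PEA₃ ∉ PromiseP` — through GMSS (`GapSVP_n ∉ prP ⟹ GapCVP_n ∉ prP`) and
`peaThreeNotInP_of_gapCVPPromise_not_mem`. [cite: DvirGutfreundRothblumVadhan2010, Thm 4.6] -/
theorem peaThreeNotInP_of_latticeGapsvpNNotP (h : LatticeGapsvpNNotP) : PeaThreeNotInP :=
  peaThreeNotInP_of_gapCVPPromise_not_mem (gapCVPPromise_not_mem_of_gapSVPPromise_not_mem _ h)


/-! ### The randomised form -/

/-- **If `GapCVP_γ` is in promise-`BPP` then so is `GapSVP_γ`** (GMSS Cook reduction through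
`GapCVP′_γ`; the `P` form is `SocketBP.gapCVPPromise_mem_PromiseP_imp`).
[cite: GoldreichMicciancioSafraSeifert1999, Thm 1; MicciancioRegev2007, Lemma 5.22] -/
theorem gapCVPPromise_mem_PromiseBPP'_imp (γ : ℕ → ℝ) (h : gapCVPPromise γ ∈ PromiseBPP') :
    gapSVPPromise γ ∈ PromiseBPP' := by
  set Qc : PromiseProblem := PromiseProblem.ofEncoding gapCVPInstanceEncoding
    {p | p ∈ GapCVP'.yes γ ∧ p.1.I.n ∈ (Set.univ : Set ℕ)}
    {p | p ∈ GapCVP'.no γ ∧ p.1.I.n ∈ (Set.univ : Set ℕ)} with hQc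
  set Qs : PromiseProblem := PromiseProblem.ofEncoding gapSVPInstanceEncoding
    {p | p ∈ GapSVP.yes γ ∧ p.1.n ∈ (Set.univ : Set ℕ)}
    {p | p ∈ GapSVP.no γ ∧ p.1.n ∈ (Set.univ : Set ℕ)} with hQs
  have hcook : Qs.CookReducible Qc := gapSVP_cookReducible_gapCVP'_holds γ Set.univ
  have hQc_mem : Qc ∈ PromiseBPP' := by
    refine mem_PromiseBPP'_of_subset ?_ ?_ h
    · rintro w ⟨p, ⟨hp, -⟩, rfl⟩
      exact ⟨p, (GapCVP'.yes_eq_gapCVP_yes γ) ▸ hp, rfl⟩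
    · rintro w ⟨p, ⟨hp, -⟩, rfl⟩
      exact ⟨p, GapCVP'.no_subset_gapCVP_no γ hp, rfl⟩
  have hQs_mem : Qs ∈ PromiseBPP' :=
    PromiseProblem.mem_PromiseBPP'_of_cookReducible_holds _ _ hcook hQc_mem
  refine mem_PromiseBPP'_of_subset ?_ ?_ hQs_mem
  · rintro w ⟨p, hp, rfl⟩
    exact ⟨p, ⟨hp, Set.mem_univ _⟩, rfl⟩
  · rintro w ⟨p, hp, rfl⟩
    exact ⟨p, ⟨hp, Set.mem_univ _⟩, rfl⟩

/-- **Randomised hardness of `GapCVP_n` puts `PEA₃` outside promise-`BPP`.**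
[cite: DvirGutfreundRothblumVadhan2010, Thm 4.6] -/
theorem not_peaThreeMemBPP_of_gapCVPPromise_not_mem
    (h : gapCVPPromise (fun n => (n : ℝ)) ∉ PromiseBPP') : ¬ PeaThreeMemBPP :=
  not_peaThreeMemBPP_of_PEDBPGap Nat.one_pos (by norm_num) fun hmem =>
    h (PromiseProblem.mem_PromiseBPP'_of_polyTimeReducible_holds' latRed_polyTimeReducible
      (swap_mem_PromiseBPP' hmem))

/-- **Randomised hardness of `GapSVP_n` (the cryptographic form of the Lattice thesis) puts `PEA₃`
outside promise-`BPP`.** [cite: DvirGutfreundRothblumVadhan2010, Thm 4.6] -/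
theorem not_peaThreeMemBPP_of_gapSVPPromise_not_mem
    (h : gapSVPPromise (fun n => (n : ℝ)) ∉ PromiseBPP') : ¬ PeaThreeMemBPP :=
  not_peaThreeMemBPP_of_gapCVPPromise_not_mem fun hc => h (gapCVPPromise_mem_PromiseBPP'_imp _ hc)

/-- … and hence the crux, by the kill-switch lemma `¬ PeaThreeMemBPP → PeaThreeNotInP`.
[cite: DvirGutfreundRothblumVadhan2010, Thm 4.6] -/
theorem peaThreeNotInP_of_gapSVPPromise_not_mem_PromiseBPP'
    (h : gapSVPPromise (fun n => (n : ℝ)) ∉ PromiseBPP') : PeaThreeNotInP :=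
  szkEntropy_peaThreeNotInP_of_not_peaThreeMemBPP (not_peaThreeMemBPP_of_gapSVPPromise_not_mem h)

end Summit.PneNP.PneNP.Cruxes.PeaThreeNotInP.LatticeLine
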